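import Summits.QuantumAdvantage.QuantumAdvantage.Theorems.CubicForrelationNearExactIsExactTwelveTypeO896DeadB
import Summits.QuantumAdvantage.QuantumAdvantage.Theorems.CubicForrelationNearExactIsExactTwelveLevelFiveHyperplaneGe2932

/-!
# Crux `CubicForrelation.NearExactIsExact` (stmt-QuantumAdvantage-14043) — n = 12: NO type-O side with base set `896` at `Φ ≥ 29/32`
  (gen 19's `Φ ≤ 29/32` sharpened to `Φ < 29/32`: the boundary `Σ v² = 64` is rigid and dies through the centre character `v̂(c₁) = ±64`)

Certificate seat `b2b-cforr-cert` (gen 22).  HONEST FRAMING: a kernel-checked theorem (standard axioms, no `decide`) about cubic Boolean pairs on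
12 bits — the base-`896` configuration of the boundary rung `29/32` is DEAD for every partner type (HOME/b2b-cforr-cert-g22/PLAN-N12-928-EQ.md).
NO new value of `θ₁₂` by itself.  NOT summit progress.

`to22_typeO_E896_ge2932_false`: cubic `f, g`, `W_g = 16u` (some `u` odd), `#E = 896`, `Φ ≥ 29/32` is impossible.  By `to19_typeO_E896_le_2932`
we are at `Φ = 29/32`: `Σ τ² = 12288`, excess `X = 1024`, so the wild function `v` (`τ = τ₀ + 8v`, `X ≥ 16Σv²`) has `Σ v² ≤ 64`.  The partner
identity with `Ê ∈ 128ℤ` (`to18_char_sum_E896`) gives `v̂(y) = 8(4(−1)^g − 64s_b[y=c₁] + 8s_b m(y) − u_f(y))`, `W_f = 16u_f`.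
(a) `f` type O: `v̂/8` odd everywhere ⇒ `Σ v̂² ≥ 4096·64` ⇒ `Σ v² = 64` with every inequality tight: `v̂(y)² = 64` for all `y`, and pointwise
`X = 16v²`, i.e. every wild point has `v = ±1`, `τ₀ = −3v`, so lies in `E` with `v = (−1)^{d₁}`; hence `v̂(c₁) = (−1)^{b₁}·#{v ≠ 0} = ±64` —
not of square `64`.  (b) `f` at level exactly 5: on the odd hyperplane of `u_f/2` (`2048` points, `tw22_oddset_card_ge2932`) `v̂ = 16·(odd)`, so
`Σ v̂² ≥ 2048·256 > 4096·64`.  (c) `f` at level `≥ 6`, `u_f = 4k`: `v̂ = 32K'` with `K'` odd exactly on the even set `Z_f` of `k`, so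
`#Z_f·1024 ≤ 4096·64`, `#Z_f ≤ 256`; but `Z_f` is nonempty (else `f` is bent and `tw_bent_end` gives `Φ ∈ {1} ∪ [0, 7/8]`) and the support
of a cubic, `≥ 512` points.

References: J. Ax (1964) / R. J. McEliece (1972); O. S. Rothaus (1976); Kasami–Tokura (1970); MacWilliams–Sloane (1977) Ch. 13–15; Carlet (2021)
§5.2.  Axioms: the standard three.
-/

set_option linter.dupNamespace false -- D-0017: single-problem summit ⇒ `QuantumAdvantage.QuantumAdvantage` by design

noncomputable section

namespace Summit.QuantumAdvantage.QuantumAdvantage.Theorems.CubicForrelation.NearExactIsExact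

open Finset
open Literature.Computability.QuantumComplexity
open Literature.Computability.QuantumComplexity.BuzetChailloux (bxor zeroVec bxor_bxor_cancel_left bxor_zeroVec zeroVec_bxor bxor_comm
  bxor_self twist_zeroVec_right twist_bxor_right)
open Literature.Computability.QuantumComplexity.DerivativeWalsh (W sum_W_sq)
open Literature.Computability.QuantumComplexity.Simon (twist_eq_one_or twist_mul_self)
open Summit.QuantumAdvantage.QuantumAdvantage.Theorems.NearExactIsExact.Negative (TypeOTwelve.typeO_of_exists_odd)

/-- **No type-O side with base set `896` at `Φ ≥ 29/32`** (12 bits).  See the module docstring.  Finite-slice statement, NOT summit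
progress. [this work] -/
theorem to22_typeO_E896_ge2932_false (f g : (Fin (6 + 6) → Bool) → Bool) (hf : IsDegLeFun 3 f) (hg : IsDegLeFun 3 g)
    (u : (Fin (6 + 6) → Bool) → ℤ) (hu : ∀ x, W (fun y => signOf (g y)) x = (2 : ℝ) ^ 4 * (u x : ℝ))
    (hodd : ∃ x, Odd (u x)) (hE : #(univ.filter fun x : Fin (6 + 6) → Bool => (Odd (u x / 2) ↔ Odd (u x / 2 / 2))) = 896)
    (hΦ : (29 / 32 : ℝ) ≤ forrelation f g) : False := by
  classical
  have hΦ' : forrelation g f = forrelation f g := by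
    rw [Summit.QuantumAdvantage.QuantumAdvantage.Theorems.SignedCubicForrelationNotPrBPP.Negative.HalfQuad.forrelation_comm]
  have hΦeq : forrelation f g = 29 / 32 := le_antisymm (to19_typeO_E896_le_2932 f g hf hg u hu hodd hE) hΦ
  have hlo' : (29 / 32 : ℝ) ≤ forrelation g f := by rw [hΦ']; exact hΦ
  have hall : ∀ x, Odd (u x) := TypeOTwelve.typeO_of_exists_odd g u hg hu hodd
  have hu' : ∀ x, W (fun y => signOf (g y)) x = (2 : ℝ) ^ (2 * 2) * (u x : ℝ) := fun x => (hu x).trans (by norm_num)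
  have hd1 : IsDegLeFun 1 (fun x => decide (Odd (u x / 2))) := z2_digitOne 2 g u hg hu' hall
  have hd2 : IsDegLeFun 3 (fun x => decide (Odd (u x / 2 / 2))) := z2_digitTwo 2 g u hg hu' hall
  obtain ⟨c₁, b₁, hcb⟩ := stub_affineForm (6 + 6) _ hd1
  set E := univ.filter (fun x : Fin (6 + 6) → Bool => (Odd (u x / 2) ↔ Odd (u x / 2 / 2))) with hEdef
  have hmemE : ∀ x, x ∈ E ↔ (Odd (u x / 2) ↔ Odd (u x / 2 / 2)) := fun x => by simp [hEdef]
  have hdegE : IsDegLeFun (2 + 1) (fun x => (decide (Odd (u x / 2)) ^^ decide (Odd (u x / 2 / 2))) ^^ true) :=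
    tb_isDegLeFun_xor_const (bb_isDegLeFun_bxor (hd1.mono (by norm_num)) hd2) true
  have hsetE : (univ.filter fun x : Fin (6 + 6) → Bool =>
      ((decide (Odd (u x / 2)) ^^ decide (Odd (u x / 2 / 2))) ^^ true) = true) = E := by
    rw [hEdef]
    apply filter_congr
    intro x _
    by_cases h1 : Odd (u x / 2) <;> by_cases h2 : Odd (u x / 2 / 2) <;> simp [h1, h2]
  have hsumE : (∑ x, (if (Odd (u x / 2) ↔ Odd (u x / 2 / 2)) then 1 else 0 : ℤ)) = #E := by rw [sum_boole]
  -- budget: exactly `Σ τ² = 12288`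
  have hbud := tw12_budget f g u hu
  have hT : (∑ x, (u x - 4 * sZ (f x)) ^ 2 : ℤ) = 12288 := by
    have h' : ((∑ x, (u x - 4 * sZ (f x)) ^ 2 : ℤ) : ℝ) = 12288 := by rw [hbud, hΦeq]; norm_num
    exact_mod_cast h'
  choose v hv using fun x => to12_pt_mod8 (u x) (sZ (f x)) (hall x) (tp_sZ_cases (f x))
  set τ₀ : (Fin (6 + 6) → Bool) → ℤ := fun x =>
    sZ (decide (Odd (u x / 2))) * (1 - 4 * (if (Odd (u x / 2) ↔ Odd (u x / 2 / 2)) then 1 else 0)) with hτ₀def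
  have hvx : ∀ x, u x - 4 * sZ (f x) = τ₀ x + 8 * v x := fun x => hv x
  have hτ₀val : ∀ x, τ₀ x = 1 ∨ τ₀ x = -1 ∨ τ₀ x = 3 ∨ τ₀ x = -3 := by
    intro x
    simp only [τ₀]
    rcases tp_sZ_cases (decide (Odd (u x / 2))) with h | h <;> rw [h] <;> split_ifs <;> norm_num
  have hτ₀sq : ∀ x, τ₀ x ^ 2 = 1 + 8 * (if (Odd (u x / 2) ↔ Odd (u x / 2 / 2)) then 1 else 0 : ℤ) := by
    intro x
    simp only [τ₀]
    rcases tp_sZ_cases (decide (Odd (u x / 2))) with h | h <;> rw [h] <;> split_ifs <;> norm_num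
  have hsumτ₀ : ∑ x, τ₀ x ^ 2 = 11264 := by
    rw [sum_congr rfl fun x _ => hτ₀sq x, sum_add_distrib, ← mul_sum, hsumE, sum_const, card_univ, Fintype.card_fun,
      Fintype.card_bool, Fintype.card_fin]
    change (4096 : ℕ) • (1 : ℤ) + 8 * ((#E : ℕ) : ℤ) = 11264
    rw [hE]; norm_num
  have hX16 : ∀ x, 16 * v x ^ 2 ≤ (τ₀ x + 8 * v x) ^ 2 - τ₀ x ^ 2 := by
    intro x
    have hv3 : v x = 0 ∨ 1 ≤ v x ∨ v x ≤ -1 := by omega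
    rcases hv3 with h0 | h1 | h1
    · rw [h0]; ring_nf; rfl
    · rcases hτ₀val x with h | h | h | h <;> rw [h] <;> nlinarith
    · rcases hτ₀val x with h | h | h | h <;> rw [h] <;> nlinarith
  have hTdec : (∑ x, (u x - 4 * sZ (f x)) ^ 2 : ℤ) = ∑ x, τ₀ x ^ 2 + ∑ x, ((τ₀ x + 8 * v x) ^ 2 - τ₀ x ^ 2) := by
    rw [← sum_add_distrib]
    exact sum_congr rfl fun x _ => by rw [hvx x]; ring
  have hXsum : ∑ x, ((τ₀ x + 8 * v x) ^ 2 - τ₀ x ^ 2) = 1024 := by rw [hTdec, hsumτ₀] at hT; linarith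
  have hXv : 16 * ∑ x, v x ^ 2 ≤ ∑ x, ((τ₀ x + 8 * v x) ^ 2 - τ₀ x ^ 2) := by rw [mul_sum]; exact sum_le_sum fun x _ => hX16 x
  have hv2 : ∑ x, v x ^ 2 ≤ 64 := by linarith
  -- the partner and the identity with `Ê ∈ 128ℤ`
  obtain ⟨uf, huf⟩ := tw_base (n := 6 + 6) f hf 4 (by norm_num)
  set Vh : (Fin (6 + 6) → Bool) → ℝ := fun y => ∑ x, (v x : ℝ) * twist x y with hVh
  have hParsV : ∑ y, Vh y ^ 2 = 4096 * ((∑ x, v x ^ 2 : ℤ) : ℝ) := by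
    have h := sum_W_sq (n := 6 + 6) (fun x => (v x : ℝ))
    unfold W at h
    rw [h]; push_cast; norm_num
  have hParsV_le : ∑ y, Vh y ^ 2 ≤ 262144 := by
    rw [hParsV]
    have : ((∑ x, v x ^ 2 : ℤ) : ℝ) ≤ 64 := by exact_mod_cast hv2
    linarith
  have hid : ∀ y, ∃ m : ℤ, Vh y = 8 * (((4 * sZ (g y) - 64 * sZ b₁ * (if bxor c₁ y = (fun _ => false) then 1 else 0) +
      8 * sZ b₁ * m - uf y : ℤ) : ℝ)) := by
    intro y
    have h := to18_typeO_partner_identity f g u hu v hv c₁ b₁ hcb uf huf y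
    rw [← hEdef] at h
    obtain ⟨m, hm⟩ := to18_char_sum_E896 _ hdegE (by rw [hsetE]; exact hE) (bxor c₁ y)
    rw [hsetE] at hm
    rw [hm] at h
    refine ⟨m, ?_⟩
    have hsg := tp_sZ_cast (g y)
    have hsb := tp_sZ_cast b₁
    simp only [Vh]
    push_cast
    rw [hsg, hsb]
    split_ifs at h ⊢ with hz
    · norm_num at h ⊢; linarith
    · linarith
  by_cases hO : ∃ y, Odd (uf y)
  · /- (a) `f` type O: the boundary `Σ v² = 64` is rigid and dies at the centre `c₁` -/
    obtain ⟨y₁, hy₁⟩ := hO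
    have hallf : ∀ y, Odd (uf y) := TypeOTwelve.typeO_of_exists_odd f uf hf huf ⟨y₁, hy₁⟩
    have h64 : ∀ y, 64 ≤ Vh y ^ 2 := by
      intro y
      obtain ⟨m, hm⟩ := hid y
      set K : ℤ := 4 * sZ (g y) - 64 * sZ b₁ * (if bxor c₁ y = (fun _ => false) then 1 else 0) + 8 * sZ b₁ * m - uf y with hKdef
      have hKodd : Odd K := by
        have h0 := Int.odd_iff.1 (hallf y)
        rw [Int.odd_iff]
        simp only [K]
        rcases tp_sZ_cases (g y) with hs | hs <;> rcases tp_sZ_cases b₁ with hs' | hs' <;> rw [hs, hs'] <;> split_ifs <;> omega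
      have hK1 : (1 : ℝ) ≤ (K : ℝ) ^ 2 := by
        have h0 := Int.odd_iff.1 hKodd
        have : K ≤ -1 ∨ 1 ≤ K := by omega
        exact_mod_cast tp_sq_ge (k := 1) (by norm_num) this
      rw [hm]; nlinarith
    -- `Σ v² = 64` and every `Vh² = 64`
    have hsum64 : (4096 : ℝ) * 64 ≤ ∑ y, Vh y ^ 2 := by
      have := sum_le_sum fun y (_ : y ∈ (univ : Finset (Fin (6 + 6) → Bool))) => h64 y
      rw [sum_const, card_univ, Fintype.card_fun, Fintype.card_bool, Fintype.card_fin] at this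
      norm_num at this ⊢; linarith
    have hv64 : ∑ x, v x ^ 2 = 64 := by
      rw [hParsV] at hsum64
      have : (64 : ℝ) ≤ ((∑ x, v x ^ 2 : ℤ) : ℝ) := by linarith
      have : (64 : ℤ) ≤ ∑ x, v x ^ 2 := by exact_mod_cast this
      linarith
    have hVall : ∀ y, Vh y ^ 2 = 64 := by
      have htot : ∑ y, (Vh y ^ 2 - 64) = 0 := by
        rw [sum_sub_distrib, hParsV, hv64, sum_const, card_univ, Fintype.card_fun, Fintype.card_bool, Fintype.card_fin]
        norm_num
      intro y
      have := (sum_eq_zero_iff_of_nonneg fun z _ => by linarith [h64 z]).1 htot y (mem_univ y)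
      linarith
    -- pointwise tightness: `X = 16 v²`, so every wild point has `v = ±1`, `τ₀ = −3v`, `v = (−1)^{d₁}`
    have hXpt : ∀ x, (τ₀ x + 8 * v x) ^ 2 - τ₀ x ^ 2 = 16 * v x ^ 2 := by
      have htot : ∑ x, ((τ₀ x + 8 * v x) ^ 2 - τ₀ x ^ 2 - 16 * v x ^ 2) = 0 := by
        rw [sum_sub_distrib, hXsum, ← mul_sum, hv64]; norm_num
      intro x
      have := (sum_eq_zero_iff_of_nonneg fun z _ => by linarith [hX16 z]).1 htot x (mem_univ x)
      linarith
    have hvS : ∀ x, v x ≠ 0 → (v x = 1 ∨ v x = -1) ∧ (v x : ℝ) = signOf b₁ * twist c₁ x := by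
      intro x hx
      have h := hXpt x
      have ht := hτ₀val x
      have hv1 : v x = 1 ∨ v x = -1 := by
        have key : 3 * v x * v x = -(τ₀ x * v x) := by nlinarith
        rcases ht with ht | ht | ht | ht <;> rw [ht] at key
        · exfalso
          have : v x * (3 * v x + 1) = 0 := by linarith
          rcases mul_eq_zero.1 this with h0 | h0
          · exact hx h0
          · omega
        · exfalso
          have : v x * (3 * v x - 1) = 0 := by linarith
          rcases mul_eq_zero.1 this with h0 | h0
          · exact hx h0
          · omega
        · have : v x * (3 * v x + 3) = 0 := by linarith
          rcases mul_eq_zero.1 this with h0 | h0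
          · exact absurd h0 hx
          · right; linarith
        · have : v x * (3 * v x - 3) = 0 := by linarith
          rcases mul_eq_zero.1 this with h0 | h0
          · exact absurd h0 hx
          · left; linarith
      refine ⟨hv1, ?_⟩
      have hvd : v x = sZ (decide (Odd (u x / 2))) := by
        simp only [τ₀] at h
        rcases hv1 with h1 | h1 <;> rw [h1] at h ⊢ <;> rcases tp_sZ_cases (decide (Odd (u x / 2))) with hs | hs <;>
          rw [hs] at h ⊢ <;> split_ifs at h <;> norm_num at h
      rw [hvd, tp_sZ_cast, hcb x]
    -- `#S = 64` and `Vh(c₁) = ±64`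
    set S := univ.filter (fun x : Fin (6 + 6) → Bool => v x ≠ 0) with hSdef
    have hScard : (#S : ℝ) = 64 := by
      have h1 : (∑ x, v x ^ 2 : ℤ) = ∑ x, (if v x ≠ 0 then 1 else 0 : ℤ) := by
        refine sum_congr rfl fun x _ => ?_
        by_cases hx : v x ≠ 0
        · rw [if_pos hx]; rcases (hvS x hx).1 with h | h <;> rw [h] <;> norm_num
        · push Not at hx; rw [if_neg (by simpa using hx), hx]; norm_num
      rw [hv64, sum_boole] at h1
      have : (#S : ℤ) = 64 := by rw [hSdef]; exact_mod_cast h1.symm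
      exact_mod_cast this
    have hVc : Vh c₁ = signOf b₁ * 64 := by
      simp only [Vh]
      rw [← sum_subset (subset_univ S) (fun x _ hx => by
        have : v x = 0 := by by_contra h; exact hx (mem_filter.2 ⟨mem_univ _, h⟩)
        rw [this]; simp)]
      rw [sum_congr rfl fun x hx => by rw [(hvS x (mem_filter.1 hx).2).2, twist_comm c₁ x, mul_assoc, twist_mul_self, mul_one],
        sum_const, nsmul_eq_mul, hScard, mul_comm]
    have h := hVall c₁
    rw [hVc, mul_pow] at h
    have hs1 : signOf b₁ ^ 2 = (1 : ℝ) := by cases b₁ <;> simp [signOf]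
    rw [hs1] at h
    norm_num at h
  push Not at hO
  have huf5 := tw_level_up (j := 4) f uf huf hO
  have hev2 : ∀ y, uf y = 2 * (uf y / 2) := fun y =>
    (Int.mul_ediv_cancel' (even_iff_two_dvd.1 (Int.not_odd_iff_even.1 (hO y)))).symm
  by_cases hO5 : ∃ y, Odd (uf y / 2)
  · /- (b) `f` at level exactly 5: `Vh² ≥ 256` on the `2048`-point odd hyperplane -/
    have hcard := tw22_oddset_card_ge2932 g f hf (fun y => uf y / 2) huf5 hO5 hlo'
    have h256 : ∀ y ∈ univ.filter (fun y : Fin (6 + 6) → Bool => Odd (uf y / 2)), (256 : ℝ) ≤ Vh y ^ 2 := by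
      intro y hy
      have hyo : Odd (uf y / 2) := (mem_filter.1 hy).2
      obtain ⟨m, hm⟩ := hid y
      set K : ℤ := 4 * sZ (g y) - 64 * sZ b₁ * (if bxor c₁ y = (fun _ => false) then 1 else 0) + 8 * sZ b₁ * m - uf y with hKdef
      have hK2 : K ≤ -2 ∨ 2 ≤ K := by
        have h0 := Int.odd_iff.1 hyo
        have h2 := hev2 y
        simp only [K]
        rcases tp_sZ_cases (g y) with hs | hs <;> rcases tp_sZ_cases b₁ with hs' | hs' <;> rw [hs, hs'] <;> split_ifs <;> omega
      have hK4 : (4 : ℝ) ≤ (K : ℝ) ^ 2 := by exact_mod_cast tp_sq_ge (k := 2) (by norm_num) hK2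
      rw [hm]; nlinarith
    have hsum : (256 : ℝ) * 2048 ≤ ∑ y, Vh y ^ 2 := by
      have h1 := sum_le_sum h256
      rw [sum_const, hcard, nsmul_eq_mul] at h1
      have h2 : ∑ y ∈ univ.filter (fun y : Fin (6 + 6) → Bool => Odd (uf y / 2)), Vh y ^ 2 ≤ ∑ y, Vh y ^ 2 :=
        sum_le_sum_of_subset_of_nonneg (subset_univ _) fun y _ _ => sq_nonneg _
      push_cast at h1
      linarith
    linarith
  · /- (c) `f` at level `≥ 6`: `Vh² ≥ 1024` on the even set of `k = u_f/4`, which has `≥ 512` points -/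
    push Not at hO5
    have huf6 := tw_level_up (j := 5) f (fun y => uf y / 2) huf5 hO5
    have hev4 : ∀ y, uf y / 2 = 2 * (uf y / 2 / 2) := fun y =>
      (Int.mul_ediv_cancel' (even_iff_two_dvd.1 (Int.not_odd_iff_even.1 (hO5 y)))).symm
    set k : (Fin (6 + 6) → Bool) → ℤ := fun y => uf y / 2 / 2 with hkdef
    have hwf : ∀ y, W (fun x => signOf (f x)) y = (2 : ℝ) ^ 6 * (k y : ℝ) := fun y => huf6 y
    have huk : ∀ y, uf y = 4 * k y := fun y => by rw [hev2 y, hev4 y]; simp only [k]; ring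
    -- not bent
    have hnotbent : ∃ y, ¬ Odd (k y) := by
      by_contra hall'
      push Not at hall'
      set u4 : (Fin (6 + 6) → Bool) → ℤ := fun y => 4 * k y with hu4def
      have hu4 : ∀ y, W (fun x => signOf (f x)) y = (2 : ℝ) ^ 4 * (u4 y : ℝ) := by
        intro y; rw [hwf y]; simp only [u4]; push_cast; ring
      have hpar : ∑ y, k y ^ 2 = 4096 := by
        have h := zms_sum_u_sq 2 f u4 (fun y => (hu4 y).trans (by norm_num))
        have e : ∑ y, ((u4 y : ℝ)) ^ 2 = 16 * ∑ y, ((k y : ℝ)) ^ 2 := by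
          rw [mul_sum]; exact sum_congr rfl fun y _ => by simp only [u4]; push_cast; ring
        rw [e] at h
        norm_num at h
        have h' : ∑ y, ((k y : ℝ)) ^ 2 = 4096 := by linarith
        exact_mod_cast h'
      have hsq1' : ∀ y, k y ^ 2 = 1 := by
        have hge : ∀ y, (1 : ℤ) ≤ k y ^ 2 := fun y => by
          have h0 := Int.odd_iff.1 (hall' y)
          have : k y ≤ -1 ∨ 1 ≤ k y := by omega
          have := tp_sq_ge (k := 1) (by norm_num) this
          linarith
        have hsum0 : ∑ y, (k y ^ 2 - 1 : ℤ) = 0 := by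
          rw [sum_sub_distrib, hpar, sum_const, card_univ, Fintype.card_fun, Fintype.card_bool, Fintype.card_fin]; norm_num
        intro y
        have := (sum_eq_zero_iff_of_nonneg fun z _ => by have := hge z; linarith).1 hsum0 y (mem_univ y)
        linarith
      have hbent : ∀ y, W (fun x => signOf (f x)) y ^ 2 = (2 : ℝ) ^ (6 + 6) := by
        intro y
        rw [hwf y, mul_pow]
        have : ((k y : ℝ)) ^ 2 = 1 := by exact_mod_cast hsq1' y
        rw [this]; norm_num
      rcases tw_bent_end (by norm_num) g f hg hf hbent with h | h
      · rw [hΦ', hΦeq] at h; norm_num at h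
      · rw [hΦ', hΦeq] at h; norm_num at h
    obtain ⟨y₁, hy₁⟩ := hnotbent
    have hp : IsDegLeFun 3 (fun y => decide (Odd (k y))) :=
      stub_walshTower stub_axParity (6 + 6) 6 3 f k hf hwf (by intro j hj hjn; omega)
    have hp' : IsDegLeFun (2 + 1) (fun y => decide (Odd (k y)) ^^ true) := tb_isDegLeFun_xor_const hp true
    set Zf := univ.filter (fun y : Fin (6 + 6) → Bool => (decide (Odd (k y)) ^^ true) = true) with hZfdef
    have hne : ∃ y, (decide (Odd (k y)) ^^ true) = true := ⟨y₁, by simpa using hy₁⟩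
    have hRM := bb_rmWeight_holds (6 + 6) 3 (fun y => decide (Odd (k y)) ^^ true) hp' hne
    have hfold : (univ.filter fun y : Fin (6 + 6) → Bool => (decide (Odd (k y)) ^^ true) = true) = Zf := rfl
    rw [hfold] at hRM
    have hZge : 512 ≤ #Zf := by
      have : (2 : ℕ) ^ (6 + 6) = 4096 := by norm_num
      rw [this] at hRM
      have : (2 : ℕ) ^ 3 = 8 := by norm_num
      rw [this] at hRM
      omega
    have h1024 : ∀ y ∈ Zf, (1024 : ℝ) ≤ Vh y ^ 2 := by
      intro y hy
      have hye : ¬ Odd (k y) := by have := (mem_filter.1 hy).2; simpa using this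
      obtain ⟨m, hm⟩ := hid y
      set K : ℤ := 4 * sZ (g y) - 64 * sZ b₁ * (if bxor c₁ y = (fun _ => false) then 1 else 0) + 8 * sZ b₁ * m - uf y with hKdef
      have hK4 : K ≤ -4 ∨ 4 ≤ K := by
        obtain ⟨j, hj⟩ := Int.not_odd_iff_even.1 hye
        have h2 := huk y
        simp only [K]
        rcases tp_sZ_cases (g y) with hs | hs <;> rcases tp_sZ_cases b₁ with hs' | hs' <;> rw [hs, hs'] <;> split_ifs <;> omega
      have hK16 : (16 : ℝ) ≤ (K : ℝ) ^ 2 := by exact_mod_cast tp_sq_ge (k := 4) (by norm_num) hK4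
      rw [hm]; nlinarith
    have hsum : (1024 : ℝ) * 512 ≤ ∑ y, Vh y ^ 2 := by
      have h1 := sum_le_sum h1024
      rw [sum_const, nsmul_eq_mul] at h1
      have h2 : ∑ y ∈ Zf, Vh y ^ 2 ≤ ∑ y, Vh y ^ 2 := sum_le_sum_of_subset_of_nonneg (subset_univ _) fun y _ _ => sq_nonneg _
      have h3 : (512 : ℝ) ≤ (#Zf : ℝ) := by exact_mod_cast hZge
      nlinarith
    linarith

/-- **A type-O side with base set `896` has `Φ < 29/32`** (12 bits).  NOT summit progress. [this work] -/
theorem to22_typeO_E896_lt_2932 (f g : (Fin (6 + 6) → Bool) → Bool) (hf : IsDegLeFun 3 f) (hg : IsDegLeFun 3 g)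
    (u : (Fin (6 + 6) → Bool) → ℤ) (hu : ∀ x, W (fun y => signOf (g y)) x = (2 : ℝ) ^ 4 * (u x : ℝ))
    (hodd : ∃ x, Odd (u x)) (hE : #(univ.filter fun x : Fin (6 + 6) → Bool => (Odd (u x / 2) ↔ Odd (u x / 2 / 2))) = 896) :
    forrelation f g < 29 / 32 := by
  by_contra h
  push Not at h
  exact to22_typeO_E896_ge2932_false f g hf hg u hu hodd hE h

end Summit.QuantumAdvantage.QuantumAdvantage.Theorems.CubicForrelation.NearExactIsExact

end
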